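import Summits.Ventures.QEDPrecision.SpectralMajorants.Partition
import HarnessLib

/-!
# The outer enclosure inequality of the I(b)/I(c) certificate, kernel side
(venture QEDPrecision, cell `pub-qed`, literature seat, gen 13; folder `SpectralMajorants/`, file 7)

HONEST FRAMING (verbatim, venture QEDPrecision): independent recomputation; certified where stated,
statistical where stated; no new-physics claim.

## What this file is

gl_bounds.md §3.4 ("Per quantity: enclosure = Σ_k Σ_i W F(X) ± Σ_k R_{Q,k} ± E_Q") as ONE kernel inequality,
for the certificate's dyadic partition with `J` sub-intervals, ANY node schedule `nS` (`nS k ≥ 1` nodes on the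
`k`-th sub-interval) and ANY ellipse parameter `ρ` with `1 < ρ`, `ρ + ρ⁻¹ < 6` (the note's "`r < 1 ⟺ s < 3 ⟺
ρ < 3 + 2√2` uniformly in `k`", here `discR_dyadic_lt_one`):

  `|Q − Σ_{k<J} GL_{nS k}[F_Q; a_k, a_{k+1}]| ≤ Σ_{k<J} R_{Q,k}(ρ, nS k) + E_Q(2^{−J})`

for `Q ∈ {setIcRep, setIbRep, groupIbEightRep (C₈), seqInsertion rho4 1 1 (C₆)}` (`abs_setIcRep_sub_glSums_le`, …),
where `GL_N[F; a, b] = Σ_{ξ ∈ gaussLegendreNodes N} ((b−a)/2·gaussLegendreWeight N ξ)·F((b−a)/2·ξ + (a+b)/2)` is the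
EXACT `N`-point Gauss–Legendre sum of the TYPED integrand, `R_{Q,k} = glRem` (file 4's `gl_remainder_*`) and
`E_Q = endBound` (file 5's `endPiece_*`).  The certificate of record is the instance `J = 30`, `ρ = 11/2`,
`nS = (14×4, 13×7, 12×6, 11×5, 10×6, 9×2)` (gl_schedule.md); its interval GL sums ∋ the exact `GL_N` (engine
node/weight enclosures, interval evaluation of `F_Q` = inner `t`-enclosures of `J₄`, §4) — THAT containment and the
outward arithmetic are the only non-kernel links left between the typed `setIbRep`/`setIcRep` and the printed
enclosures.  No number moves; not an R-row.  NEW WORK of the cell, not a published result; nothing here is cited as a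
fact anywhere; no numerical value of any anomaly integral is asserted.
-/

noncomputable section

open Real Set MeasureTheory intervalIntegral Finset

namespace Summit.Ventures.QEDPrecision.SpectralMajorants

open Literature.MathematicalPhysics.QuantumFieldTheory.Jegerlehner2017
open Literature.Analysis.SpecialFunctions (gaussLegendreNodes gaussLegendreWeight)

/-! ### The pieces of the inequality -/

/-- The exact `N`-point Gauss–Legendre sum of `f` on `[a,b]` (the kernel theorem's sum, real form). -/
def glSum (f : ℝ → ℝ) (N : ℕ) (a b : ℝ) : ℝ :=
  ∑ ξ ∈ gaussLegendreNodes N, ((b - a) / 2 * gaussLegendreWeight N ξ) * f ((b - a) / 2 * ξ + (a + b) / 2)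

/-- `R_{Q,k}(ρ, N) = h·8·M_Q/((ρ−1)ρ^{2N−1})` (gl_bounds.md §3.2; `b1p_lib.gl_remainder`). -/
def glRem (cQ : ℝ) (m n : ℕ) (a b ρ : ℝ) (N : ℕ) : ℝ :=
  (b - a) / 2 * (8 * mQ cQ m n a b ρ / ((ρ - 1) * ρ ^ (2 * N - 1)))

/-- `E_Q(η) = c(1/3)^m(19/2)^n·η²Σ_{i≤N} C(N,i)i!ln^{N−i}(1/η)/2^{i+1}` (gl_bounds.md §5; `b1p_lib.end_piece_bound`
with `ln(1/η)` exact). -/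
def endBound (cQ : ℝ) (m n : ℕ) (η : ℝ) : ℝ :=
  cQ * (1 / 3) ^ m * (19 / 2) ^ n * (η ^ 2 * ∑ i ∈ range (m + n + 1),
    ((m + n).choose i : ℝ) * (i.factorial : ℝ) * log (1 / η) ^ (m + n - i) / 2 ^ (i + 1))

/-! ### The dyadic partition is admissible for every `ρ` with `ρ + ρ⁻¹ < 6` -/

/-- `a_k < a_{k+1}` for `k ≤ J`. -/
theorem dyadicPt_lt_succ {J k : ℕ} (hk : k < J + 1) : dyadicPt J k < dyadicPt J (k + 1) := by
  have hkJ : k ≤ J := Nat.lt_succ_iff.mp hk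
  rw [dyadicPt_of_le hkJ]
  have hp : (0:ℝ) < (1 / 2) ^ k := by positivity
  by_cases h : k + 1 ≤ J
  · rw [dyadicPt_of_le h, pow_succ]
    nlinarith
  · have : k + 1 = J + 1 := by omega
    rw [this, dyadicPt_succ]
    linarith

/-- `0 ≤ a_k`. -/
theorem dyadicPt_nonneg (J k : ℕ) : 0 ≤ dyadicPt J k := (dyadicPt_mem J k).1

/-- **`r_k < 1` uniformly** (gl_bounds.md §2.5 / R60-2): on `[a_k, a_{k+1}] = [1−p, 1−p/2]` (`p = 2^{−k}`, `k < J`)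
the disc radius is `r = 1 − (3 − s)p/4 < 1` as soon as `s = (ρ+ρ⁻¹)/2 < 3`. -/
theorem discR_dyadic_lt_one {ρ : ℝ} (hρ : ρ + ρ⁻¹ < 6) {J k : ℕ} (hk : k < J) :
    discR (dyadicPt J k) (dyadicPt J (k + 1)) ρ < 1 := by
  rw [dyadicPt_of_le hk.le, dyadicPt_of_le hk, pow_succ]
  unfold discR
  have hp : (0:ℝ) < (1 / 2) ^ k := by positivity
  nlinarith

/-! ### The generic inequality -/

/-- **Outer enclosure inequality, generic**: for `0 ≤ c_Q`, `1 < ρ`, `ρ + ρ⁻¹ < 6`, any `J` and any schedule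
`nS` with `nS k ≥ 1`:
`|∫₀¹ F_Q − Σ_{k<J} GL_{nS k}[F_Q; a_k, a_{k+1}]| ≤ Σ_{k<J} R_{Q,k}(ρ, nS k) + E_Q(2^{−J})`. -/
theorem abs_integral_sub_glSums_le {cQ : ℝ} (hc : 0 ≤ cQ) (m n : ℕ) {ρ : ℝ} (hρ1 : 1 < ρ)
    (hρ6 : ρ + ρ⁻¹ < 6) (J : ℕ) (nS : ℕ → ℕ) (hnS : ∀ k, 1 ≤ nS k) :
    |(∫ x in (0:ℝ)..1, fQre cQ m n x)
        - ∑ k ∈ range J, glSum (fQre cQ m n) (nS k) (dyadicPt J k) (dyadicPt J (k + 1))| ≤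
      (∑ k ∈ range J, glRem cQ m n (dyadicPt J k) (dyadicPt J (k + 1)) ρ (nS k))
        + endBound cQ m n ((1 / 2) ^ J) := by
  -- split ∫₀¹ over the J sub-intervals and the end piece
  rw [integral_fQre_eq_sum hc m n (dyadicPt J) (J + 1) (dyadicPt_zero J) (dyadicPt_succ J)
    (fun k _ => dyadicPt_mem J k), Finset.sum_range_succ]
  -- the end piece
  have hE : |∫ x in dyadicPt J J..dyadicPt J (J + 1), fQre cQ m n x| ≤ endBound cQ m n ((1 / 2) ^ J) := by
    rw [dyadicPt_of_le le_rfl, dyadicPt_succ]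
    exact abs_integral_endPiece_le hc m n (by positivity) (pow_le_one₀ (by norm_num) (by norm_num))
  -- the per-interval remainders
  have hR : ∀ k ∈ range J,
      |(∫ x in dyadicPt J k..dyadicPt J (k + 1), fQre cQ m n x)
        - glSum (fQre cQ m n) (nS k) (dyadicPt J k) (dyadicPt J (k + 1))| ≤
        glRem cQ m n (dyadicPt J k) (dyadicPt J (k + 1)) ρ (nS k) := by
    intro k hk
    have hk' : k < J := Finset.mem_range.mp hk
    exact gl_remainder_fQre hc m n (dyadicPt_nonneg J k) (dyadicPt_lt_succ (by omega)) hρ1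
      (discR_dyadic_lt_one hρ6 hk') (hnS k)
  have hsum := Finset.abs_sum_le_sum_abs (fun k =>
      (∫ x in dyadicPt J k..dyadicPt J (k + 1), fQre cQ m n x)
        - glSum (fQre cQ m n) (nS k) (dyadicPt J k) (dyadicPt J (k + 1))) (range J)
  have hsum' := Finset.sum_le_sum hR
  have e : (∑ k ∈ range J, ∫ x in dyadicPt J k..dyadicPt J (k + 1), fQre cQ m n x)
      + (∫ x in dyadicPt J J..dyadicPt J (J + 1), fQre cQ m n x)
      - ∑ k ∈ range J, glSum (fQre cQ m n) (nS k) (dyadicPt J k) (dyadicPt J (k + 1))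
      = (∑ k ∈ range J, ((∫ x in dyadicPt J k..dyadicPt J (k + 1), fQre cQ m n x)
          - glSum (fQre cQ m n) (nS k) (dyadicPt J k) (dyadicPt J (k + 1))))
        + ∫ x in dyadicPt J J..dyadicPt J (J + 1), fQre cQ m n x := by
    rw [Finset.sum_sub_distrib]; ring
  rw [e]
  calc _ ≤ |∑ k ∈ range J, ((∫ x in dyadicPt J k..dyadicPt J (k + 1), fQre cQ m n x)
          - glSum (fQre cQ m n) (nS k) (dyadicPt J k) (dyadicPt J (k + 1)))|
        + |∫ x in dyadicPt J J..dyadicPt J (J + 1), fQre cQ m n x| := abs_add_le _ _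
    _ ≤ _ := by linarith [hsum, hsum']

/-! ### The four quantities of the certificate -/

/-- **I(c)**: `|setIcRep − Σ_{k<J} GL_{nS k}[(1−x)J₄²; a_k, a_{k+1}]| ≤ Σ_{k<J} R_{I(c),k} + E_{I(c)}`. -/
theorem abs_setIcRep_sub_glSums_le {ρ : ℝ} (hρ1 : 1 < ρ) (hρ6 : ρ + ρ⁻¹ < 6) (J : ℕ) (nS : ℕ → ℕ)
    (hnS : ∀ k, 1 ≤ nS k) :
    |setIcRep - ∑ k ∈ range J,
        glSum (fun x => (1 - x) * (∫ t in (0:ℝ)..1, rho4 t / wt t x 1) ^ 2) (nS k)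
          (dyadicPt J k) (dyadicPt J (k + 1))| ≤
      (∑ k ∈ range J, glRem 1 0 2 (dyadicPt J k) (dyadicPt J (k + 1)) ρ (nS k)) + endBound 1 0 2 ((1 / 2) ^ J) := by
  have h := abs_integral_sub_glSums_le zero_le_one 0 2 hρ1 hρ6 J nS hnS
  have e : (fun x => (1 - x) * (∫ t in (0:ℝ)..1, rho4 t / wt t x 1) ^ 2) = fQre 1 0 2 := by
    funext x; rw [fQre_Ic]
  rw [setIcRep_eq_integral_fQre, e]
  exact h

/-- **I(b)**: `|setIbRep − Σ_{k<J} GL_{nS k}[3(1−x)K²J₄; a_k, a_{k+1}]| ≤ Σ_{k<J} R_{I(b),k} + E_{I(b)}`. -/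
theorem abs_setIbRep_sub_glSums_le {ρ : ℝ} (hρ1 : 1 < ρ) (hρ6 : ρ + ρ⁻¹ < 6) (J : ℕ) (nS : ℕ → ℕ)
    (hnS : ∀ k, 1 ≤ nS k) :
    |setIbRep - ∑ k ∈ range J,
        glSum (fun x => 3 * (1 - x) * (∫ t in (0:ℝ)..1, rho2 t / wt t x 1) ^ 2
          * (∫ t in (0:ℝ)..1, rho4 t / wt t x 1)) (nS k) (dyadicPt J k) (dyadicPt J (k + 1))| ≤
      (∑ k ∈ range J, glRem 3 2 1 (dyadicPt J k) (dyadicPt J (k + 1)) ρ (nS k)) + endBound 3 2 1 ((1 / 2) ^ J) := by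
  have h := abs_integral_sub_glSums_le (by norm_num : (0:ℝ) ≤ 3) 2 1 hρ1 hρ6 J nS hnS
  have e : (fun x => 3 * (1 - x) * (∫ t in (0:ℝ)..1, rho2 t / wt t x 1) ^ 2
      * (∫ t in (0:ℝ)..1, rho4 t / wt t x 1)) = fQre 3 2 1 := by
    funext x; rw [fQre_Ib]
  rw [setIbRep_eq_integral_fQre, e]
  exact h

/-- **C₈ (control)**: `|groupIbEightRep − Σ_{k<J} GL_{nS k}[2(1−x)KJ₄; a_k, a_{k+1}]| ≤ Σ_{k<J} R_{C₈,k} + E_{C₈}`. -/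
theorem abs_groupIbEightRep_sub_glSums_le {ρ : ℝ} (hρ1 : 1 < ρ) (hρ6 : ρ + ρ⁻¹ < 6) (J : ℕ) (nS : ℕ → ℕ)
    (hnS : ∀ k, 1 ≤ nS k) :
    |groupIbEightRep - ∑ k ∈ range J,
        glSum (fun x => 2 * (1 - x) * (∫ t in (0:ℝ)..1, rho2 t / wt t x 1)
          * (∫ t in (0:ℝ)..1, rho4 t / wt t x 1)) (nS k) (dyadicPt J k) (dyadicPt J (k + 1))| ≤
      (∑ k ∈ range J, glRem 2 1 1 (dyadicPt J k) (dyadicPt J (k + 1)) ρ (nS k)) + endBound 2 1 1 ((1 / 2) ^ J) := by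
  have h := abs_integral_sub_glSums_le (by norm_num : (0:ℝ) ≤ 2) 1 1 hρ1 hρ6 J nS hnS
  have e : (fun x => 2 * (1 - x) * (∫ t in (0:ℝ)..1, rho2 t / wt t x 1)
      * (∫ t in (0:ℝ)..1, rho4 t / wt t x 1)) = fQre 2 1 1 := by
    funext x; rw [fQre_C8]
  rw [groupIbEightRep_eq_integral_fQre, e]
  exact h

/-- **C₆ (shakedown)**: `|seqInsertion rho4 1 1 − Σ_{k<J} GL_{nS k}[(1−x)J₄; a_k, a_{k+1}]| ≤ Σ_{k<J} R_{C₆,k} + E_{C₆}`. -/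
theorem abs_seqInsertion_rho4_sub_glSums_le {ρ : ℝ} (hρ1 : 1 < ρ) (hρ6 : ρ + ρ⁻¹ < 6) (J : ℕ) (nS : ℕ → ℕ)
    (hnS : ∀ k, 1 ≤ nS k) :
    |seqInsertion rho4 1 1 - ∑ k ∈ range J,
        glSum (fun x => (1 - x) * (∫ t in (0:ℝ)..1, rho4 t / wt t x 1)) (nS k)
          (dyadicPt J k) (dyadicPt J (k + 1))| ≤
      (∑ k ∈ range J, glRem 1 0 1 (dyadicPt J k) (dyadicPt J (k + 1)) ρ (nS k)) + endBound 1 0 1 ((1 / 2) ^ J) := by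
  have h := abs_integral_sub_glSums_le zero_le_one 0 1 hρ1 hρ6 J nS hnS
  have e : (fun x => (1 - x) * (∫ t in (0:ℝ)..1, rho4 t / wt t x 1)) = fQre 1 0 1 := by
    funext x; rw [fQre_C6]
  rw [seqInsertion_rho4_one_one_eq_integral_fQre, e]
  exact h

/-- The certificate's parameters are admissible: `ρ = 11/2` has `1 < ρ` and `ρ + ρ⁻¹ = 5.68… < 6`. -/
theorem rho_of_record_admissible : (1 : ℝ) < 11 / 2 ∧ (11 / 2 : ℝ) + (11 / 2)⁻¹ < 6 := by
  constructor <;> norm_num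

end Summit.Ventures.QEDPrecision.SpectralMajorants

end
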